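import Summits.BirchSwinnertonDyer.BirchSwinnertonDyer.Theorems.SignedLowerHalvesKobayashiLowerHalfSemistableDefmuOddPrimeDescent
import HarnessLib

/-!
# Line «defmu» of crux 2 `KobayashiLowerHalfSemistable` (stmt-BirchSwinnertonDyer-19000) AT AN ODD PRIME — part 3/3: Cμ′ / Cμ at odd `p`,
# and the `p = 3` residual S7 `stub_threeResidual` RE-ITEMISED ⟸ the two v5 cite packs ⊕ BSTW Thm 6.17 at odd `p` (untyped
# preprint claim, displayed) ⊕ Pollack–Weston 2011 Lemma 2.1 (published, displayed)

Route-independent `Theorems` file (cell `bsd-ssimc`, seat `bsd-line-slh-p2`, LEAD of crux 2, gen 18); part 3 of the «defmu at an odd prime»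
series (parts 1/2: `…DefmuOddPrimeFrame.lean`, `…DefmuOddPrimeDescent.lean`; memo `Lines/defmu-at-three.md`). HONEST FRAMING: nothing about any curve is asserted, NO summit statement is proved, BSD / the crux is NOT proved; every theorem is an
IMPLICATION from hypotheses displayed in full.

The two displayed print statements of this part:
* `h617odd` — BSTW Thm 6.17 at an odd supersingular prime with `a_p = 0` (print: "`p ∤ 2N`, (h4) `a_p(E) = 0` if `p = 3`"; the tree's
  binder is typed at `5 ≤ p`). UNREFEREED PREPRINT CLAIM; at `p = 3` precisely where the cell's referees located the residual (3-ii)♭′ + B1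
  (bstw-MEMO-10). Never asserted.
* `hL21` — Pollack–Weston 2011 Lemma 2.1 ("there is some `m ∈ M` such that `⟨m, g_f⟩` is a unit", Compos. Math. 147 §2.1, proved in their
  §6.3 from Takahashi), in the tree's currency `∃ c, p ∤ w_c φ_c` for a generator `φ` of the `a(E)`-eigen-line (the hypothesis `hnorm` of
  `pollackWeston2011_thm_2_5_hasMuZeroLAc`), displayed UNDER PW's standing hypotheses (p. 2: `N = N⁺N⁻` square-free, `p ∤ N` odd, (CR): `ρ̄`
  surjective and ramified at the primes of `N⁻` — here `p ∤ v_q(Δ_E)` at EVERY `q ∣ N⁻`, which at `p = 3` is exactly (CR), every `q ≠ 3`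
  being `≡ ±1 (mod 3)`); PUBLISHED; at `p ≥ 5` the conclusion is the tree theorem `SemistableDefmuMuCarrierV4.exists_not_dvd_weight_mul_apply`.

THIS PART: Cμ′ / Cμ at odd `p` (`definitePackageMuCarrier_odd_of_pinned`, `exists_package_odd_of_muCarrier`), then
**`threeResidual_of_citePacks`: S7's signature VERBATIM ⟸ `stub_publishedInputs` ∧ `stub_preprintInputs` ∧ `h617odd` ∧ `hL21`** and
`kobayashiLowerHalfSemistable_body_of_citePacks_odd` (the crux BODY, NO research stub). Reading: crux 2 as a WHOLE is closed modulo 12 printed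
statements — 10 typed names (PUB 7, PRE 3; skeleton v5) + 2 untyped (BSTW 6.17 at odd `p`: PRE, referee-flagged at 3; PW Lemma 2.1: PUB);
typing the two lets a skeleton v6 cite them BY NAME and retire `stub_threeResidual`. Kernel state of the crux: UNCHANGED (OPEN; PRE).

References: [BurungaleSkinnerTianWan2024] Thms. 6.17, 9.24, II 10.5, §2.3; [PollackWeston2011] Lemma 2.1, §6.3, Thm. 2.5; [Mazur1978] Cor. 4.1. -/

set_option linter.dupNamespace false -- D-0017: single-problem summit, the namespace repeats the problem name by design
set_option autoImplicit false

noncomputable section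

open scoped Classical
open NumberField IsDedekindDomain Field CongruenceSubgroup
open Literature.NumberTheory.GaloisRepresentations
open Literature.NumberTheory.EllipticCurves Literature.NumberTheory.EllipticCurves.BurungaleSkinnerTianWan2024
open Literature.NumberTheory.EllipticCurves.ModularForms
open Literature.NumberTheory.Automorphic
open Summit.BirchSwinnertonDyer.BirchSwinnertonDyer.Theorems.SignedBaseChangeK1FrameData
open Summit.BirchSwinnertonDyer.BirchSwinnertonDyer.Theorems.SignedBaseChangeK2RTransferDescent
open Summit.BirchSwinnertonDyer.BirchSwinnertonDyer.Theorems.SemistableDefmuAssembly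

namespace Summit.BirchSwinnertonDyer.BirchSwinnertonDyer.Theorems.SemistableDefmuOddPrime

/-! ### §4. Cμ′ and Cμ at any odd prime -/

/-- **Cμ′ at any odd prime from the (P4b) binder** (twin of `SemistableDefmuMuCarrierPinned.definitePackageMuCarrier_of_pinned` with the
binder `5 ≤ p` dropped — its proof never used it; `thm105def_…_PRE` is typed at `p ≠ 2`): the signed two-variable package with a definite
`μ`-carrier, GRANTED the binder, modularity and multiplicity one BY NAME; the carrier from `SemistableDefmuMuCarrierPinned.exists_muCarrier`.
CONDITIONAL; closes nothing. [claim: BurungaleSkinnerTianWan2024, status: under-review]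
[cite: BurungaleSkinnerTianWan2024, Part II Thm. 10.5 proof, case (def)] [cite: Takahashi2001, §2 p. 78] [cite: BertoliniDarmon1996, Lemma 2.2 and §2.4] -/
theorem definitePackageMuCarrier_odd_of_pinned
    (h105 : thm105def_exists_signedTwoVariablePackage_pinnedToGrossPoints_supersingular_PRE)
    (hmod : nonempty_modularParametrizationData) (hT1 : takahashi2001_brandtEigenLattice_rank_one) :
  ∀ {p : ℕ} [Fact p.Prime] (ι : PadicAlgCl p ≃+* ℂ) (W : WeierstrassCurve ℚ) [W.IsElliptic]
    [W.IsGloballyMinimal] (K : Type) [Field K] [NumberField K] (v vbar : HeightOneSpectrum (𝓞 K))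
    (κ₁ κ₂ : ZpExtension K p) (γ₁ γ₂ : absoluteGaloisGroup K)
    [Fact (ZpExtension.IsTopGeneratorPair κ₁ κ₂ γ₁ γ₂)] {N : ℕ} [NeZero N] (f : CuspForm (Gamma0 N) 2)
    [NeZero (NumberField.discr K).natAbs],
    IsNewformOf W f → (N : ℤ) = W.conductorNorm ℤ → p ≠ 2 → ¬ (p : ℤ) ∣ W.conductorNorm ℤ →
    W.frobeniusTrace p = 0 →
    IsImaginaryQuadratic K → ((Ideal.span {(p : ℤ)}).primesOver (𝓞 K)).ncard = 2 →
    ((p : ℕ) : 𝓞 K) ∈ v.asIdeal → ((p : ℕ) : 𝓞 K) ∈ vbar.asIdeal → vbar ≠ v →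
    (∀ (w : InfinitePlace K) (k : 𝓞 K), k ∈ v.asIdeal ↔ ‖ι.symm (w.embedding (k : K))‖ < 1) →
    IsCoprime (N : ℤ) (NumberField.discr K) →
    -- ⟨definite-CR datum at an ODD prime: X6; ONE prime q₀ ∥ N inert in K, every other ℓ ∣ N split; `2` split or
    --  `2 ∣ N` ((spl) of BSTW Thm 9.24); (CR, RAMIFIED branch only) `p ∤ v_{q₀}(Δ_W)` (ρ̄ ramified at q₀, `p ∤ c_{q₀}`)⟩
    Rank1Residual.ClassX6 W p →
    ∀ q₀ : ℕ, q₀.Prime → q₀ ∣ N → ¬ (q₀ ^ 2 ∣ N) →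
      ((Ideal.span {(q₀ : ℤ)}).primesOver (𝓞 K)).ncard = 1 →
      (∀ ℓ : ℕ, ℓ.Prime → ℓ ∣ N → ℓ ≠ q₀ → ((Ideal.span {(ℓ : ℤ)}).primesOver (𝓞 K)).ncard = 2) →
      (((Ideal.span {(2 : ℤ)}).primesOver (𝓞 K)).ncard = 2 ∨ 2 ∣ N) →
      ¬ ((p : ℤ) ∣ padicValRat q₀ W.Δ) →
    (∀ ρ : ModPGaloisRep K (ZMod p) 2, (W.baseChange K).IsTorsionGaloisRep p ρ →
      FramedRep.IsAbsolutelyIrreducible ρ) →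
    κ₁.IsCyclotomic → κ₂.IsAnticyclotomic →
    ∀ (Ω δ : ℂ) (Ωp : (unrIntegers p)ˣ) (LK G : PowerSeries (PowerSeries (PadicComplexInt p))),
      Ω ≠ 0 → (δ ^ 2 = (NumberField.discr K : ℂ) ∨ δ ^ 2 = -(NumberField.discr K : ℂ)) →
      IsKatzMeasure₂ ι v vbar ∅ κ₁ κ₂ γ₁⁻¹ γ₂⁻¹ 1 Ω δ ((Ωp : unrIntegers p) : PadicComplex p) LK →
      IsGreenbergLFunctionAnyRoot₂ ι v vbar κ₁ κ₂ γ₁⁻¹ γ₂⁻¹ f (NumberField.discr K).natAbs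
        (NumberField.classNumber K) LK G →
    ∀ J : ℤ_[p] →+* PadicComplexInt p,
      (∀ x : ℤ_[p], ((J x : PadicComplexInt p) : PadicComplex p) = ((x : ℚ_[p]) : PadicComplex p)) →
    ∀ ε : ℤˣ,
    ∃ xi Lsig : PowerSeries (PowerSeries (PadicComplexInt p)),
      (∃ (S : Brandt.XiSetup (N / q₀) q₀) (_ : Fintype (Brandt.ClassSet S.O))
          (φ : Brandt.ClassSet S.O → ℤ) (T : GrossPointTower K S p),
          φ ≠ 0 ∧
          Brandt.eigenLattice (N / q₀ * q₀) (Brandt.matrix S.O) (fun n => W.LFunction n) = ℤ ∙ φ ∧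
          (T.HasMuZeroLAc p φ → GreenbergVatsal2000.HasUnitContent (UnrSeries₂.minus Lsig))) ∧
      (Ideal.span {xi * G} =
          (WeierstrassCurve.XGr₂.charIdeal (W.baseChange K) p κ₁ κ₂ vbar γ₁ γ₂).map
              (IwasawaAlgebra₂.toUnr₂ p J) * Ideal.span {Lsig} ∧
      ∀ (κ : ZpExtension ℚ p) (γ : absoluteGaloisGroup ℚ), κ.IsCyclotomic → κ.IsTopGenerator γ →
        IsCyclotomicVariable p γ →
        (∃ ζ : ℤ_[p]ˣ, IsOfFinOrder ζ ∧
          GaloisRep.cyclotomicCharacter ℚ p γ * ζ = GaloisRep.cyclotomicCharacter K p γ₁) →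
        ∀ (W₂ : WeierstrassCurve ℚ) [W₂.IsElliptic] [W₂.IsGloballyMinimal]
          (C₂ : WeierstrassCurve.VariableChange ℚ),
          C₂ • W₂ = W.quadraticTwist (NumberField.discr K : ℚ) →
          (∀ (D₁ : Kobayashi2003.SignedSelmerDualData W κ γ ε)
              (D₂ : Kobayashi2003.SignedSelmerDualData W₂ κ γ ε) (g₁ g₂ : IwasawaAlgebra p),
              D₁.charIdeal = Ideal.span {g₁} → D₂.charIdeal = Ideal.span {g₂} →
              UnrSeries₂.plus xi ∣ PowerSeries.map J (g₁ * g₂)) ∧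
          (∀ {N₂ : ℕ} [NeZero N₂] (f₂ : CuspForm (Gamma0 N₂) 2), IsNewformOf W₂ f₂ →
            ∀ (L₁ L₂ : IwasawaAlgebra p), Kobayashi2003.IsSignedPAdicLFunction f p ε L₁ →
              Kobayashi2003.IsSignedPAdicLFunction f₂ p ε L₂ →
              ∃ u : PowerSeries (PadicComplexInt p), IsUnit u ∧
                UnrSeries₂.plus Lsig = u * PowerSeries.map J (L₁ * L₂))) := by
  intro p _ ι W _ _ K _ _ v vbar κ₁ κ₂ γ₁ γ₂ _ N _ f _ hf hN hp hpN ha0 hIQ hsp hv hvbar hvv hι hcop hX q₀ hq₀ hqN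
    hq2 hin hspl h2K hCR hirr hκ₁ hκ₂ Ω δ Ωp LK G hΩ hδ hLK hGr J hJ ε
  have hNnat : N = W.conductorNorm ℤ := by exact_mod_cast hN
  have hsq : Squarefree N := by
    rw [hNnat]
    exact (W.isSemistable_iff_squarefree_conductorNorm).mp
      ((Rank1Residual.semistable_iff_isSemistable_int (W := W)).mp hX.2.1)
  have hodd : Odd (NumberField.discr K) := by
    rcases h2K with h2 | h2
    · have h8 := (Literature.NumberTheory.QuadraticFields.Quadratic.ncard_primesOver_two_eq_two_iff hIQ.1).mp h2
      rw [Int.odd_iff]; omega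
    · have h2N : (2 : ℤ) ∣ (N : ℤ) := by exact_mod_cast h2
      have hnd : ¬ (2 : ℤ) ∣ NumberField.discr K := fun hd =>
        Int.prime_two.not_unit (hcop.isUnit_of_dvd' h2N hd)
      rw [Int.odd_iff]; omega
  obtain ⟨S, instF, φ, T, hφ0, hφ⟩ :=
    SemistableDefmuMuCarrierPinned.exists_muCarrier hmod hT1 W K hN hp hIQ hsp hcop hX hq₀ hqN hq2 hin hspl (p := p)
  exact exists_muCarrier_of_pinned h105 ι W K v vbar κ₁ κ₂ γ₁ γ₂ f hf hN hp hpN ha0 hIQ hsp hv hvbar hvv hι hcop hsq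
    hodd hq₀ hqN hin hspl hCR hirr hκ₁ hκ₂ Ω δ Ωp LK G hΩ hδ hLK hGr J hJ ε S φ hφ0 hφ T

/-- **Cμ′ ⊕ Pollack–Weston Thm 2.5 (i) ⊕ Lemma 2.1 ⟹ Cμ, pointwise, at any odd prime** (twin of
`SemistableDefmuMuCarrierV4.exists_package_of_muCarrier`, whose normalisation came from `5 ≤ p`; here it comes from the displayed
hypothesis `hL21` = Pollack–Weston's Lemma 2.1 in the tree's currency). In the binders of Cμ: if the package exists with a definite
`μ`-carrier `(S, φ, T)`, then it exists WITH unit content on the anticyclotomic line, GRANTED `pollackWeston2011_thm_2_5_hasMuZeroLAc`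
(`hPW`) and Lemma 2.1 (`hL21`) BY NAME / displayed. CONDITIONAL; closes nothing. [cite: PollackWeston2011, §2.1 Lemma 2.1, Thm. 2.5 (i)]
[cite: BurungaleSkinnerTianWan2024, Part II Thm. 10.5 proof, case (def)] -/
theorem exists_package_odd_of_muCarrier
    (hPW : ∀ (K : Type) [Field K] [NumberField K] {Nplus Nminus : ℕ} (S : Brandt.XiSetup Nplus Nminus)
      (p : ℕ) [Fact p.Prime] (W : WeierstrassCurve ℚ), pollackWeston2011_thm_2_5_hasMuZeroLAc K S p W)
    (hL21 : ∀ (p : ℕ) [Fact p.Prime] (W : WeierstrassCurve ℚ) [W.IsElliptic] [W.IsGloballyMinimal]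
        {Nplus Nminus : ℕ} (S : Brandt.XiSetup Nplus Nminus) [Fintype (Brandt.ClassSet S.O)],
        p ≠ 2 → Nplus * Nminus = W.conductorNorm ℤ → Squarefree (Nplus * Nminus) → ¬ p ∣ Nplus * Nminus →
        Rank1Residual.Surj W p → (∀ q : ℕ, q.Prime → q ∣ Nminus → ¬ ((p : ℤ) ∣ padicValRat q W.Δ)) →
        ∀ (φ : Brandt.ClassSet S.O → ℤ), φ ≠ 0 →
          Brandt.eigenLattice (Nplus * Nminus) (Brandt.matrix S.O) (fun n => W.LFunction n) = ℤ ∙ φ →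
          ∃ c : Brandt.ClassSet S.O, ¬ (p : ℤ) ∣ (Brandt.weight S.O c : ℤ) * φ c)
    {p : ℕ} [Fact p.Prime] (W : WeierstrassCurve ℚ) [W.IsElliptic] [W.IsGloballyMinimal]
    (K : Type) [Field K] [NumberField K] (vbar : HeightOneSpectrum (𝓞 K))
    (κ₁ κ₂ : ZpExtension K p) (γ₁ γ₂ : absoluteGaloisGroup K) [Fact (ZpExtension.IsTopGeneratorPair κ₁ κ₂ γ₁ γ₂)]
    {N : ℕ} [NeZero N] (f : CuspForm (Gamma0 N) 2)
    (hN : (N : ℤ) = W.conductorNorm ℤ) (hp : p ≠ 2) (ha0 : W.frobeniusTrace p = 0)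
    (hIQ : IsImaginaryQuadratic K)
    (hsp : ((Ideal.span {(p : ℤ)}).primesOver (𝓞 K)).ncard = 2) (hcop : IsCoprime (N : ℤ) (NumberField.discr K))
    (hX : Rank1Residual.ClassX6 W p) {q₀ : ℕ} (hq₀ : q₀.Prime) (hqN : q₀ ∣ N) (hq2 : ¬ (q₀ ^ 2 ∣ N))
    (hin : ((Ideal.span {(q₀ : ℤ)}).primesOver (𝓞 K)).ncard = 1)
    (hspl : ∀ ℓ : ℕ, ℓ.Prime → ℓ ∣ N → ℓ ≠ q₀ → ((Ideal.span {(ℓ : ℤ)}).primesOver (𝓞 K)).ncard = 2)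
    (hCR : ¬ ((p : ℤ) ∣ padicValRat q₀ W.Δ))
    (G : PowerSeries (PowerSeries (PadicComplexInt p))) (J : ℤ_[p] →+* PadicComplexInt p) (ε : ℤˣ)
    (hC' :
      ∃ xi Lsig : PowerSeries (PowerSeries (PadicComplexInt p)),
        (∃ (S : Brandt.XiSetup (N / q₀) q₀) (_ : Fintype (Brandt.ClassSet S.O))
            (φ : Brandt.ClassSet S.O → ℤ) (T : GrossPointTower K S p),
            φ ≠ 0 ∧
            Brandt.eigenLattice (N / q₀ * q₀) (Brandt.matrix S.O) (fun n => W.LFunction n) = ℤ ∙ φ ∧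
            (T.HasMuZeroLAc p φ → GreenbergVatsal2000.HasUnitContent (UnrSeries₂.minus Lsig))) ∧
        (Ideal.span {xi * G} =
            (WeierstrassCurve.XGr₂.charIdeal (W.baseChange K) p κ₁ κ₂ vbar γ₁ γ₂).map
                (IwasawaAlgebra₂.toUnr₂ p J) * Ideal.span {Lsig} ∧
        ∀ (κ : ZpExtension ℚ p) (γ : absoluteGaloisGroup ℚ), κ.IsCyclotomic → κ.IsTopGenerator γ →
          IsCyclotomicVariable p γ →
          (∃ ζ : ℤ_[p]ˣ, IsOfFinOrder ζ ∧
            GaloisRep.cyclotomicCharacter ℚ p γ * ζ = GaloisRep.cyclotomicCharacter K p γ₁) →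
          ∀ (W₂ : WeierstrassCurve ℚ) [W₂.IsElliptic] [W₂.IsGloballyMinimal]
            (C₂ : WeierstrassCurve.VariableChange ℚ),
            C₂ • W₂ = W.quadraticTwist (NumberField.discr K : ℚ) →
            (∀ (D₁ : Kobayashi2003.SignedSelmerDualData W κ γ ε)
                (D₂ : Kobayashi2003.SignedSelmerDualData W₂ κ γ ε) (g₁ g₂ : IwasawaAlgebra p),
                D₁.charIdeal = Ideal.span {g₁} → D₂.charIdeal = Ideal.span {g₂} →
                UnrSeries₂.plus xi ∣ PowerSeries.map J (g₁ * g₂)) ∧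
            (∀ {N₂ : ℕ} [NeZero N₂] (f₂ : CuspForm (Gamma0 N₂) 2), IsNewformOf W₂ f₂ →
              ∀ (L₁ L₂ : IwasawaAlgebra p), Kobayashi2003.IsSignedPAdicLFunction f p ε L₁ →
                Kobayashi2003.IsSignedPAdicLFunction f₂ p ε L₂ →
                ∃ u : PowerSeries (PadicComplexInt p), IsUnit u ∧
                  UnrSeries₂.plus Lsig = u * PowerSeries.map J (L₁ * L₂)))) :
    ∃ xi Lsig : PowerSeries (PowerSeries (PadicComplexInt p)),
      GreenbergVatsal2000.HasUnitContent (UnrSeries₂.minus Lsig) ∧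
      (Ideal.span {xi * G} =
          (WeierstrassCurve.XGr₂.charIdeal (W.baseChange K) p κ₁ κ₂ vbar γ₁ γ₂).map
              (IwasawaAlgebra₂.toUnr₂ p J) * Ideal.span {Lsig} ∧
      ∀ (κ : ZpExtension ℚ p) (γ : absoluteGaloisGroup ℚ), κ.IsCyclotomic → κ.IsTopGenerator γ →
        IsCyclotomicVariable p γ →
        (∃ ζ : ℤ_[p]ˣ, IsOfFinOrder ζ ∧
          GaloisRep.cyclotomicCharacter ℚ p γ * ζ = GaloisRep.cyclotomicCharacter K p γ₁) →
        ∀ (W₂ : WeierstrassCurve ℚ) [W₂.IsElliptic] [W₂.IsGloballyMinimal]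
          (C₂ : WeierstrassCurve.VariableChange ℚ),
          C₂ • W₂ = W.quadraticTwist (NumberField.discr K : ℚ) →
          (∀ (D₁ : Kobayashi2003.SignedSelmerDualData W κ γ ε)
              (D₂ : Kobayashi2003.SignedSelmerDualData W₂ κ γ ε) (g₁ g₂ : IwasawaAlgebra p),
              D₁.charIdeal = Ideal.span {g₁} → D₂.charIdeal = Ideal.span {g₂} →
              UnrSeries₂.plus xi ∣ PowerSeries.map J (g₁ * g₂)) ∧
          (∀ {N₂ : ℕ} [NeZero N₂] (f₂ : CuspForm (Gamma0 N₂) 2), IsNewformOf W₂ f₂ →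
            ∀ (L₁ L₂ : IwasawaAlgebra p), Kobayashi2003.IsSignedPAdicLFunction f p ε L₁ →
              Kobayashi2003.IsSignedPAdicLFunction f₂ p ε L₂ →
              ∃ u : PowerSeries (PadicComplexInt p), IsUnit u ∧
                UnrSeries₂.plus Lsig = u * PowerSeries.map J (L₁ * L₂))) := by
  obtain ⟨xi, Lsig, ⟨S, _instF, φ, T, hφ0, hφ, hμ⟩, hP1, hline⟩ := hC'
  have hNnat : N = W.conductorNorm ℤ := by exact_mod_cast hN
  have hmul : N / q₀ * q₀ = N := Nat.div_mul_cancel hqN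
  have hNc : N / q₀ * q₀ = W.conductorNorm ℤ := hmul.trans hNnat
  have hsq : Squarefree (N / q₀ * q₀) := by
    rw [hNc]
    exact (W.isSemistable_iff_squarefree_conductorNorm).mp
      ((Rank1Residual.semistable_iff_isSemistable_int (W := W)).mp hX.2.1)
  have hpN : ¬ p ∣ N / q₀ * q₀ := by
    rw [hNc]; exact not_dvd_conductorNorm_of_hasGoodReductionAtPrime W hX.1.1
  have hsurj : Rank1Residual.Surj W p := Rank1Residual.ClassX6.surj W p hp hX
  have hram : ∀ q : ℕ, q.Prime → q ∣ q₀ → ¬ ((p : ℤ) ∣ padicValRat q W.Δ) := by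
    intro q hq hqd
    obtain rfl := (Nat.prime_dvd_prime_iff_eq hq hq₀).mp hqd
    exact hCR
  have hnorm : ∃ c : Brandt.ClassSet S.O, ¬ (p : ℤ) ∣ (Brandt.weight S.O c : ℤ) * φ c :=
    hL21 p W S hp hNc hsq hpN hsurj hram φ hφ0 hφ
  exact ⟨xi, Lsig,
    hμ (SemistableDefmuMuCarrier.hasMuZeroLAc_of_pollackWeston hPW W K hN hp ha0 hIQ hsp hcop hX hq₀ hqN hq2 hin hspl S φ
      hφ0 hφ hnorm T),
    hP1, hline⟩

/-! ### §5. S7 and the crux body from the two cite packs ⊕ BSTW 6.17 at odd `p` ⊕ PW Lemma 2.1 (both displayed) -/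

/-- **The lower divisibility at ANY odd X6 prime with `a_p = 0` from the two v5 CITE PACKS, BSTW Thm 6.17 at odd `p` (displayed,
UNTYPED preprint claim `h617odd`) and Pollack–Weston Lemma 2.1 (displayed, published, `hL21`).** `hpub` / `hpre` are the texts of
`stub_publishedInputs` / `stub_preprintInputs` of skeleton v5. Composition: §3 at S1aʳ ⟸ §4 (modularity via
`exists_isNewformOf_of_nonempty_modularParametrizationData`, Diamond 1995), Cμ ⟸ §4 (`definitePackageMuCarrier_odd_of_pinned` ⊕
`exists_package_odd_of_muCarrier`), the rest BY NAME. CONDITIONAL (`conditional-result`); closes nothing.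
[claim: BurungaleSkinnerTianWan2024, status: under-review] [cite: BurungaleSkinnerTianWan2024, Thm. 6.17, Thm. 9.24, Part II Thm. 10.5 proof case (def), §2.3]
[cite: PollackWeston2011, §2.1 Lemma 2.1, Thm. 2.5 (i)] [cite: Kobayashi2003, Thm. 1.2, Thm. 4.1] [cite: Mazur1978, Cor. 4.1] [cite: Diamond1995RefinedSerre, Thm. 1.1] -/
theorem exists_kobayashiLowerDivisibility_odd_of_citePacks
    (hpub :
      Kobayashi2003.thm12_signedSelmerDual_finite_torsion ∧ Kobayashi2003.thm41_signedCharIdeal_divisibility ∧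
        nonempty_modularParametrizationData ∧ takahashi2001_brandtEigenLattice_rank_one ∧
        mazur_not_dvd_maninConstant_of_odd ∧
        Literature.NumberTheory.Automorphic.diamond1995_refinedSerre ∧
        (∀ (K : Type) [Field K] [NumberField K] {Nplus Nminus : ℕ} (S : Brandt.XiSetup Nplus Nminus)
          (p : ℕ) [Fact p.Prime] (W : WeierstrassCurve ℚ), pollackWeston2011_thm_2_5_hasMuZeroLAc K S p W))
    (hpre :
      thm617_exists_isGreenbergLFunctionAnyRoot₂_supersingular_PRE ∧
        thm924_greenberg_dvd_charIdealXGr₂_awayFromCyc_OPEN ∧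
        thm105def_exists_signedTwoVariablePackage_pinnedToGrossPoints_supersingular_PRE)
    (h617odd :
        ∀ {p : ℕ} [Fact p.Prime] (ι : PadicAlgCl p ≃+* ℂ) (W : WeierstrassCurve ℚ) [W.IsElliptic]
          [W.IsGloballyMinimal] (K : Type) [Field K] [NumberField K] (v vbar : HeightOneSpectrum (𝓞 K))
          (κ₁ κ₂ : ZpExtension K p) (γ₁ γ₂ : absoluteGaloisGroup K)
          [Fact (ZpExtension.IsTopGeneratorPair κ₁ κ₂ γ₁ γ₂)] {N : ℕ} [NeZero N] {f : CuspForm (Gamma0 N) 2}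
          (_ : IsNewformOf W f) [NeZero (NumberField.discr K).natAbs],
          -- `g = f_E` of level `N = N_E`; `p` ODD of good SUPERSINGULAR reduction: `p ∤ N_E`, `a_p(E) = 0`
          (N : ℤ) = W.conductorNorm ℤ → p ≠ 2 → ¬ (p : ℤ) ∣ W.conductorNorm ℤ → W.frobeniusTrace p = 0 →
          -- `L = K` imaginary quadratic; (h2) `p = v v̄` split, `v` induced by `ι`; (h1) `(N, D_K) = 1`
          IsImaginaryQuadratic K → ((Ideal.span {(p : ℤ)}).primesOver (𝓞 K)).ncard = 2 →
          ((p : ℕ) : 𝓞 K) ∈ v.asIdeal → ((p : ℕ) : 𝓞 K) ∈ vbar.asIdeal → vbar ≠ v →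
          (∀ (w : InfinitePlace K) (k : 𝓞 K), k ∈ v.asIdeal ↔ ‖ι.symm (w.embedding (k : K))‖ < 1) →
          IsCoprime (N : ℤ) (NumberField.discr K) →
          -- the `ℤ_p²`-tower: `κ₁` cyclotomic, `κ₂` anticyclotomic, generator pair `(γ₁, γ₂)`
          κ₁.IsCyclotomic → κ₂.IsAnticyclotomic →
          -- a Katz frame (period data + Katz's two-variable measure) and `G = 𝓛_p^Gr(f/K)` in it
          ∃ (Ω δ : ℂ) (Ωp : (unrIntegers p)ˣ) (LK G : PowerSeries (PowerSeries (PadicComplexInt p))),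
            Ω ≠ 0 ∧ (δ ^ 2 = (NumberField.discr K : ℂ) ∨ δ ^ 2 = -(NumberField.discr K : ℂ)) ∧
            IsKatzMeasure₂ ι v vbar ∅ κ₁ κ₂ γ₁⁻¹ γ₂⁻¹ 1 Ω δ ((Ωp : unrIntegers p) : ℂ_[p]) LK ∧
            IsGreenbergLFunctionAnyRoot₂ ι v vbar κ₁ κ₂ γ₁⁻¹ γ₂⁻¹ f (NumberField.discr K).natAbs
              (NumberField.classNumber K) LK G)
    (hL21 : ∀ (p : ℕ) [Fact p.Prime] (W : WeierstrassCurve ℚ) [W.IsElliptic] [W.IsGloballyMinimal]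
        {Nplus Nminus : ℕ} (S : Brandt.XiSetup Nplus Nminus) [Fintype (Brandt.ClassSet S.O)],
        p ≠ 2 → Nplus * Nminus = W.conductorNorm ℤ → Squarefree (Nplus * Nminus) → ¬ p ∣ Nplus * Nminus →
        Rank1Residual.Surj W p → (∀ q : ℕ, q.Prime → q ∣ Nminus → ¬ ((p : ℤ) ∣ padicValRat q W.Δ)) →
        ∀ (φ : Brandt.ClassSet S.O → ℤ), φ ≠ 0 →
          Brandt.eigenLattice (Nplus * Nminus) (Brandt.matrix S.O) (fun n => W.LFunction n) = ℤ ∙ φ →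
          ∃ c : Brandt.ClassSet S.O, ¬ (p : ℤ) ∣ (Brandt.weight S.O c : ℤ) * φ c)
    (W : WeierstrassCurve ℚ) [W.IsElliptic] [W.IsGloballyMinimal] (p : ℕ) [Fact p.Prime]
    (hp : p ≠ 2) (hX : Rank1Residual.ClassX6 W p) (ha0 : W.frobeniusTrace p = 0) :
    ∃ ε : ℤˣ, Summit.BirchSwinnertonDyer.Rank1Residual.Supersingular.KobayashiLowerDivisibility W p ε := by
  refine exists_kobayashiLowerDivisibility_odd_of_package
    (ramifiedLevelPrimeR_odd_of_levelLowering
      (exists_isNewformOf_of_nonempty_modularParametrizationData hpub.2.2.1) hpub.2.2.2.2.2.1)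
    ?_ h617odd hpub.1 hpub.2.1 hpub.2.2.1 hpub.2.2.2.2.1 hpre.2.1 W p hp hX ha0
  intro p _ ι W _ _ K _ _ v vbar κ₁ κ₂ γ₁ γ₂ _ N _ f _ hf hN hp hpN ha0 hIQ hsp hv hvbar hvv hι hcop hX q₀ hq₀ hqN hq2
    hin hspl h2K hCR hirr hκ₁ hκ₂ Ω δ Ωp LK G hΩ hδ hLK hGr J hJ ε
  exact exists_package_odd_of_muCarrier hpub.2.2.2.2.2.2 hL21 W K vbar κ₁ κ₂ γ₁ γ₂ f hN hp ha0 hIQ hsp hcop hX hq₀ hqN hq2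
    hin hspl hCR G J ε
    (definitePackageMuCarrier_odd_of_pinned hpre.2.2 hpub.2.2.1 hpub.2.2.2.1 ι W K v vbar κ₁ κ₂ γ₁ γ₂ f hf hN hp hpN ha0
      hIQ hsp hv hvbar hvv hι hcop hX q₀ hq₀ hqN hq2 hin hspl h2K hCR hirr hκ₁ hκ₂ Ω δ Ωp LK G hΩ hδ hLK hGr J hJ ε)

/-- **The `p = 3` residual S7 `stub_threeResidual` of line «defmu» (signature VERBATIM since v1) RE-ITEMISED**: it follows from the
two v5 cite packs (`stub_publishedInputs`, `stub_preprintInputs`), BSTW Thm 6.17 at odd supersingular `p` (`h617odd`, UNTYPED preprint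
claim; at `p = 3` exactly where the cell's referees located (3-ii)♭′) and Pollack–Weston 2011 Lemma 2.1 (`hL21`, PUBLISHED, untyped).
X6 at `3` forces `a₃ = 0` (the class's third clause). So the line «defmu» HAS a mechanism at `p = 3`: the same one, and crux 2's last
research stub is print-shaped. CONDITIONAL (`conditional-result`); it does NOT close the registered stub (two displayed hypotheses are
not tree declarations); nothing is asserted; BSD / the crux NOT proved. [claim: BurungaleSkinnerTianWan2024, status: under-review]
[cite: BurungaleSkinnerTianWan2024, Thm. 1.3 (p = 3), Thm. 6.17] [cite: PollackWeston2011, §2.1 Lemma 2.1] [cite: Kobayashi2003, Conjecture (p. 2)] -/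
theorem threeResidual_of_citePacks
    (hpub :
      Kobayashi2003.thm12_signedSelmerDual_finite_torsion ∧ Kobayashi2003.thm41_signedCharIdeal_divisibility ∧
        nonempty_modularParametrizationData ∧ takahashi2001_brandtEigenLattice_rank_one ∧
        mazur_not_dvd_maninConstant_of_odd ∧
        Literature.NumberTheory.Automorphic.diamond1995_refinedSerre ∧
        (∀ (K : Type) [Field K] [NumberField K] {Nplus Nminus : ℕ} (S : Brandt.XiSetup Nplus Nminus)
          (p : ℕ) [Fact p.Prime] (W : WeierstrassCurve ℚ), pollackWeston2011_thm_2_5_hasMuZeroLAc K S p W))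
    (hpre :
      thm617_exists_isGreenbergLFunctionAnyRoot₂_supersingular_PRE ∧
        thm924_greenberg_dvd_charIdealXGr₂_awayFromCyc_OPEN ∧
        thm105def_exists_signedTwoVariablePackage_pinnedToGrossPoints_supersingular_PRE)
    (h617odd :
        ∀ {p : ℕ} [Fact p.Prime] (ι : PadicAlgCl p ≃+* ℂ) (W : WeierstrassCurve ℚ) [W.IsElliptic]
          [W.IsGloballyMinimal] (K : Type) [Field K] [NumberField K] (v vbar : HeightOneSpectrum (𝓞 K))
          (κ₁ κ₂ : ZpExtension K p) (γ₁ γ₂ : absoluteGaloisGroup K)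
          [Fact (ZpExtension.IsTopGeneratorPair κ₁ κ₂ γ₁ γ₂)] {N : ℕ} [NeZero N] {f : CuspForm (Gamma0 N) 2}
          (_ : IsNewformOf W f) [NeZero (NumberField.discr K).natAbs],
          -- `g = f_E` of level `N = N_E`; `p` ODD of good SUPERSINGULAR reduction: `p ∤ N_E`, `a_p(E) = 0`
          (N : ℤ) = W.conductorNorm ℤ → p ≠ 2 → ¬ (p : ℤ) ∣ W.conductorNorm ℤ → W.frobeniusTrace p = 0 →
          -- `L = K` imaginary quadratic; (h2) `p = v v̄` split, `v` induced by `ι`; (h1) `(N, D_K) = 1`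
          IsImaginaryQuadratic K → ((Ideal.span {(p : ℤ)}).primesOver (𝓞 K)).ncard = 2 →
          ((p : ℕ) : 𝓞 K) ∈ v.asIdeal → ((p : ℕ) : 𝓞 K) ∈ vbar.asIdeal → vbar ≠ v →
          (∀ (w : InfinitePlace K) (k : 𝓞 K), k ∈ v.asIdeal ↔ ‖ι.symm (w.embedding (k : K))‖ < 1) →
          IsCoprime (N : ℤ) (NumberField.discr K) →
          -- the `ℤ_p²`-tower: `κ₁` cyclotomic, `κ₂` anticyclotomic, generator pair `(γ₁, γ₂)`
          κ₁.IsCyclotomic → κ₂.IsAnticyclotomic →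
          -- a Katz frame (period data + Katz's two-variable measure) and `G = 𝓛_p^Gr(f/K)` in it
          ∃ (Ω δ : ℂ) (Ωp : (unrIntegers p)ˣ) (LK G : PowerSeries (PowerSeries (PadicComplexInt p))),
            Ω ≠ 0 ∧ (δ ^ 2 = (NumberField.discr K : ℂ) ∨ δ ^ 2 = -(NumberField.discr K : ℂ)) ∧
            IsKatzMeasure₂ ι v vbar ∅ κ₁ κ₂ γ₁⁻¹ γ₂⁻¹ 1 Ω δ ((Ωp : unrIntegers p) : ℂ_[p]) LK ∧
            IsGreenbergLFunctionAnyRoot₂ ι v vbar κ₁ κ₂ γ₁⁻¹ γ₂⁻¹ f (NumberField.discr K).natAbs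
              (NumberField.classNumber K) LK G)
    (hL21 : ∀ (p : ℕ) [Fact p.Prime] (W : WeierstrassCurve ℚ) [W.IsElliptic] [W.IsGloballyMinimal]
        {Nplus Nminus : ℕ} (S : Brandt.XiSetup Nplus Nminus) [Fintype (Brandt.ClassSet S.O)],
        p ≠ 2 → Nplus * Nminus = W.conductorNorm ℤ → Squarefree (Nplus * Nminus) → ¬ p ∣ Nplus * Nminus →
        Rank1Residual.Surj W p → (∀ q : ℕ, q.Prime → q ∣ Nminus → ¬ ((p : ℤ) ∣ padicValRat q W.Δ)) →
        ∀ (φ : Brandt.ClassSet S.O → ℤ), φ ≠ 0 →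
          Brandt.eigenLattice (Nplus * Nminus) (Brandt.matrix S.O) (fun n => W.LFunction n) = ℤ ∙ φ →
          ∃ c : Brandt.ClassSet S.O, ¬ (p : ℤ) ∣ (Brandt.weight S.O c : ℤ) * φ c) :
    ∀ (W : WeierstrassCurve ℚ) [W.IsElliptic] [W.IsGloballyMinimal], Rank1Residual.ClassX6 W 3 →
      ∃ ε : ℤˣ, Summit.BirchSwinnertonDyer.Rank1Residual.Supersingular.KobayashiLowerDivisibility W 3 ε := by
  intro W _ _ hX
  exact exists_kobayashiLowerDivisibility_odd_of_citePacks hpub hpre h617odd hL21 W 3 (by decide) hX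
    (hX.2.2.resolve_left (by decide))

/-- **The BODY of crux 2 from the two cite packs ⊕ BSTW 6.17 at odd `p` ⊕ PW Lemma 2.1 — NO research stub.** The v5 body
`SemistableDefmuMuCarrierPinned.kobayashiLowerHalfSemistable_body_of_citePacks` with S7 supplied by `threeResidual_of_citePacks`.
The composition target of a future skeleton v6 once the two displayed statements are typed as `Literature` declarations (then
`stub_threeResidual` retires and crux 2 reads «closed mod print: 12 names»). CONDITIONAL (`conditional-result`); closes nothing; the
item stays OPEN (PRE). [claim: BurungaleSkinnerTianWan2024, status: under-review] [cite: BurungaleSkinnerTianWan2024, Thm. 1.3, Thm. 6.17, Thm. 9.24, Part II Thm. 10.5]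
[cite: PollackWeston2011, §2.1 Lemma 2.1, Thm. 2.5 (i)] [cite: Kobayashi2003, Conjecture (p. 2), Thm. 1.2, Thm. 4.1] -/
theorem kobayashiLowerHalfSemistable_body_of_citePacks_odd
    (hpub :
      Kobayashi2003.thm12_signedSelmerDual_finite_torsion ∧ Kobayashi2003.thm41_signedCharIdeal_divisibility ∧
        nonempty_modularParametrizationData ∧ takahashi2001_brandtEigenLattice_rank_one ∧
        mazur_not_dvd_maninConstant_of_odd ∧
        Literature.NumberTheory.Automorphic.diamond1995_refinedSerre ∧
        (∀ (K : Type) [Field K] [NumberField K] {Nplus Nminus : ℕ} (S : Brandt.XiSetup Nplus Nminus)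
          (p : ℕ) [Fact p.Prime] (W : WeierstrassCurve ℚ), pollackWeston2011_thm_2_5_hasMuZeroLAc K S p W))
    (hpre :
      thm617_exists_isGreenbergLFunctionAnyRoot₂_supersingular_PRE ∧
        thm924_greenberg_dvd_charIdealXGr₂_awayFromCyc_OPEN ∧
        thm105def_exists_signedTwoVariablePackage_pinnedToGrossPoints_supersingular_PRE)
    (h617odd :
        ∀ {p : ℕ} [Fact p.Prime] (ι : PadicAlgCl p ≃+* ℂ) (W : WeierstrassCurve ℚ) [W.IsElliptic]
          [W.IsGloballyMinimal] (K : Type) [Field K] [NumberField K] (v vbar : HeightOneSpectrum (𝓞 K))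
          (κ₁ κ₂ : ZpExtension K p) (γ₁ γ₂ : absoluteGaloisGroup K)
          [Fact (ZpExtension.IsTopGeneratorPair κ₁ κ₂ γ₁ γ₂)] {N : ℕ} [NeZero N] {f : CuspForm (Gamma0 N) 2}
          (_ : IsNewformOf W f) [NeZero (NumberField.discr K).natAbs],
          -- `g = f_E` of level `N = N_E`; `p` ODD of good SUPERSINGULAR reduction: `p ∤ N_E`, `a_p(E) = 0`
          (N : ℤ) = W.conductorNorm ℤ → p ≠ 2 → ¬ (p : ℤ) ∣ W.conductorNorm ℤ → W.frobeniusTrace p = 0 →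
          -- `L = K` imaginary quadratic; (h2) `p = v v̄` split, `v` induced by `ι`; (h1) `(N, D_K) = 1`
          IsImaginaryQuadratic K → ((Ideal.span {(p : ℤ)}).primesOver (𝓞 K)).ncard = 2 →
          ((p : ℕ) : 𝓞 K) ∈ v.asIdeal → ((p : ℕ) : 𝓞 K) ∈ vbar.asIdeal → vbar ≠ v →
          (∀ (w : InfinitePlace K) (k : 𝓞 K), k ∈ v.asIdeal ↔ ‖ι.symm (w.embedding (k : K))‖ < 1) →
          IsCoprime (N : ℤ) (NumberField.discr K) →
          -- the `ℤ_p²`-tower: `κ₁` cyclotomic, `κ₂` anticyclotomic, generator pair `(γ₁, γ₂)`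
          κ₁.IsCyclotomic → κ₂.IsAnticyclotomic →
          -- a Katz frame (period data + Katz's two-variable measure) and `G = 𝓛_p^Gr(f/K)` in it
          ∃ (Ω δ : ℂ) (Ωp : (unrIntegers p)ˣ) (LK G : PowerSeries (PowerSeries (PadicComplexInt p))),
            Ω ≠ 0 ∧ (δ ^ 2 = (NumberField.discr K : ℂ) ∨ δ ^ 2 = -(NumberField.discr K : ℂ)) ∧
            IsKatzMeasure₂ ι v vbar ∅ κ₁ κ₂ γ₁⁻¹ γ₂⁻¹ 1 Ω δ ((Ωp : unrIntegers p) : ℂ_[p]) LK ∧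
            IsGreenbergLFunctionAnyRoot₂ ι v vbar κ₁ κ₂ γ₁⁻¹ γ₂⁻¹ f (NumberField.discr K).natAbs
              (NumberField.classNumber K) LK G)
    (hL21 : ∀ (p : ℕ) [Fact p.Prime] (W : WeierstrassCurve ℚ) [W.IsElliptic] [W.IsGloballyMinimal]
        {Nplus Nminus : ℕ} (S : Brandt.XiSetup Nplus Nminus) [Fintype (Brandt.ClassSet S.O)],
        p ≠ 2 → Nplus * Nminus = W.conductorNorm ℤ → Squarefree (Nplus * Nminus) → ¬ p ∣ Nplus * Nminus →
        Rank1Residual.Surj W p → (∀ q : ℕ, q.Prime → q ∣ Nminus → ¬ ((p : ℤ) ∣ padicValRat q W.Δ)) →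
        ∀ (φ : Brandt.ClassSet S.O → ℤ), φ ≠ 0 →
          Brandt.eigenLattice (Nplus * Nminus) (Brandt.matrix S.O) (fun n => W.LFunction n) = ℤ ∙ φ →
          ∃ c : Brandt.ClassSet S.O, ¬ (p : ℤ) ∣ (Brandt.weight S.O c : ℤ) * φ c) :
    ∀ (W : WeierstrassCurve ℚ) [W.IsElliptic] [W.IsGloballyMinimal] (p : ℕ) [Fact p.Prime], p ≠ 2 →
      Rank1Residual.ClassX6 W p →
      ∃ ε : ℤˣ, Summit.BirchSwinnertonDyer.Rank1Residual.Supersingular.KobayashiLowerDivisibility W p ε :=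
  SemistableDefmuMuCarrierPinned.kobayashiLowerHalfSemistable_body_of_citePacks hpub hpre
    (threeResidual_of_citePacks hpub hpre h617odd hL21)

end Summit.BirchSwinnertonDyer.BirchSwinnertonDyer.Theorems.SemistableDefmuOddPrime
end
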